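import Mathlib

/-!
# Norm-one depth is odd (ENGINE B, pub-hlocus abs-2 g50) — helper anchor

certified instances and evidence bearing on the general Hodge conjecture; no claim.

Integral core of LEMMA N1 (DERIVATIONS_engineB §67.4), the source of the CLASS-LEVEL HORIZON LAWS: in
`ℚ₃(π)`, `π² = -3`, a norm-one element `λ = (a + b π)/2 ≡ 1 (mod π)` has `v_π(λ - 1)` ODD, namely
`v_π(λ - 1) = 2 v₃(b) + 1`, because `(a - 2)(a + 2) = -3 b²` with `a + 2` a unit gives
`v₃(a - 2) = 2 v₃(b) + 1 > v_π(bπ)/2`. Consequently the depth `max_t v_π(λ - ζᵗ)` of the norm-one cocycle of a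
twist is odd (≥ 3) or infinite, which yields the parities and the closed forms of the twist horizons
(REAL: `H_σ = ω`, …; IMAGINARY: `H_σι = 2 v₃(Y) + 1`, `H_ι = 1 + κ`; √3: `H_σ = H_σι = 1`, `H_ι = 1 + κ`),
certified with 0 violations on 11 524 classes (LAW-H). The statement below is the truncated (mod `3^N`)
integral form: the norm-one equation is only required modulo `3^N` with `N ≥ 2 v₃(b) + 2`, which is what a
3-adic unit of norm one supplies at every finite precision.
-/

set_option linter.dupNamespace false

namespace Summit.HodgeConjecture.HodgeConjecture.HodgeLocus.Census.NormOneDepthB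

/-- LEMMA N1, truncated integral form: if `a² + 3 b² ≡ 4 (mod 3^N)`, `a ≡ 2 (mod 3)`, `v₃(b) = k` exactly and
`N ≥ 2k + 2`, then `v₃(a - 2) = 2k + 1` exactly. -/
theorem normOne_depth (a c q : ℤ) (k N : ℕ) (hN : 2 * k + 2 ≤ N)
    (h : a ^ 2 + 3 * (3 ^ k * c) ^ 2 = 4 + 3 ^ N * q) (ha : 3 ∣ a - 2) (hc : ¬ 3 ∣ c) :
    3 ^ (2 * k + 1) ∣ a - 2 ∧ ¬ 3 ^ (2 * k + 2) ∣ a - 2 := by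
  have hid : (a - 2) * (a + 2) = 3 ^ N * q - 3 ^ (2 * k + 1) * c ^ 2 := by
    have e : (3 : ℤ) ^ (2 * k + 1) = 3 * (3 ^ k) ^ 2 := by ring
    rw [e]; linear_combination h
  have hunit : ¬ (3 : ℤ) ∣ a + 2 := by
    intro h2
    have h4 : (3 : ℤ) ∣ (a + 2) - (a - 2) := dvd_sub h2 ha
    have h5 : (3 : ℤ) ∣ 4 := by
      have e : (a + 2) - (a - 2) = 4 := by ring
      rwa [e] at h4
    revert h5; decide
  have hNpow : ∀ j, j ≤ N → (3 : ℤ) ^ j ∣ 3 ^ N * q := fun j hj =>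
    dvd_mul_of_dvd_left (pow_dvd_pow 3 hj) q
  constructor
  · have h1 : (3 : ℤ) ^ (2 * k + 1) ∣ (a - 2) * (a + 2) := by
      rw [hid]
      exact dvd_sub (hNpow _ (by omega)) (dvd_mul_right _ _)
    have hcop : IsCoprime ((3 : ℤ) ^ (2 * k + 1)) (a + 2) :=
      IsCoprime.pow_left ((Prime.coprime_iff_not_dvd Int.prime_three).mpr hunit)
    exact hcop.dvd_of_dvd_mul_right h1
  · intro hdeep
    have h1 : (3 : ℤ) ^ (2 * k + 2) ∣ (a - 2) * (a + 2) := dvd_mul_of_dvd_left hdeep _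
    rw [hid] at h1
    have h2 : (3 : ℤ) ^ (2 * k + 2) ∣ 3 ^ (2 * k + 1) * c ^ 2 := by
      have := dvd_sub (hNpow _ hN) h1
      simpa using this
    have h3 : (3 : ℤ) ^ (2 * k + 1) * 3 ∣ 3 ^ (2 * k + 1) * c ^ 2 := by
      have e : (3 : ℤ) ^ (2 * k + 2) = 3 ^ (2 * k + 1) * 3 := by ring
      rwa [e] at h2
    have h4 : (3 : ℤ) ∣ c ^ 2 :=
      (mul_dvd_mul_iff_left (pow_ne_zero _ (by norm_num : (3 : ℤ) ≠ 0))).mp h3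
    exact hc (Int.prime_three.dvd_of_dvd_pow h4)

/-- The parity consequence used by the horizon laws: the 3-adic valuation `2k+1` of `a - 2` is odd, so in
`π`-adic units `v_π(λ - 1) = min (2(2k+1), 2k+1) = 2k+1` is odd. Recorded as the trivial arithmetic fact. -/
theorem depth_odd (k : ℕ) : ¬ 2 ∣ 2 * k + 1 := by omega

/-- The exact identity behind the lemma. -/
theorem key_identity (a b : ℤ) : (a - 2) * (a + 2) + 3 * b ^ 2 = (a ^ 2 + 3 * b ^ 2) - 4 := by ring

/-- Truncated witnesses (norm-one units of `ℤ₃[ζ₃]` to finite precision): `k = 0`: `a = 8, b = 1`,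
`a² + 3b² = 67 = 4 + 3²·7`, `v₃(a - 2) = v₃ 6 = 1`; `k = 1`: `a = 56, b = 3`, `a² + 3b² = 3163 = 4 + 3⁴·39`,
`v₃(a - 2) = v₃ 54 = 3`. -/
theorem witness_k0 : (8 : ℤ) ^ 2 + 3 * (3 ^ 0 * 1) ^ 2 = 4 + 3 ^ 2 * 7 ∧ (3 : ℤ) ^ 1 ∣ 8 - 2 ∧
    ¬ (3 : ℤ) ^ 2 ∣ 8 - 2 := by
  refine ⟨by norm_num, by norm_num, by decide⟩

/-- Truncated witness with `k = 1`: `a = 56, b = 3`, `a² + 3b² = 3163 = 4 + 3⁴·39`, `v₃(a - 2) = 3`. -/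
theorem witness_k1 : (56 : ℤ) ^ 2 + 3 * (3 ^ 1 * 1) ^ 2 = 4 + 3 ^ 4 * 39 ∧ (3 : ℤ) ^ 3 ∣ 56 - 2 ∧
    ¬ (3 : ℤ) ^ 4 ∣ 56 - 2 := by
  refine ⟨by norm_num, by norm_num, by decide⟩

end Summit.HodgeConjecture.HodgeConjecture.HodgeLocus.Census.NormOneDepthB
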